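import Literature.NumberTheory.Weil1964.AdelicCompactFamilyDominated
import Literature.NumberTheory.Weil1964.AdelicMetaplecticModulusNormalisation
import HarnessLib

/-!
# Dominated families IV: any implementer family of bounded modulus over a dominated one is dominated

Topic `NumberTheory/Weil1964`; namespace `Literature.NumberTheory.Weil1964`.  KERNEL mathematics only (theorems; no
definition, no named fact, no `axiom`, no proof hole).

In the tree the kernel of `π : Mp_ψ(W_𝔸)ᶜᵒⁿᵗ → Sp(W_𝔸)` is `ℂˣ` (not `S¹`): two implementers `q, q'` of the same
symplectic element differ by a scalar `t`, and `‖(ω(q')Φ)(x)‖ = √(L(q')/L(q)) · ‖(ω(q)Φ)(x)‖` with `L = l2Scaling` the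
`L²`-modulus (★ `AdelicMetaplecticModulusNormalisation.adelicMpCont.norm_omega_apply_of_proj_eq`, [Weil1964] Chap. I
n° 13).  Consequently Weil's Lemme 5 ([Weil1964] Chap. III n° 41, p. 194) transfers from ONE dominated implementer
family to EVERY implementer family over the same symplectic elements whose moduli stay in a compact range — the form in
which the boundedness argument of [Weil1965] Chap. V n° 50 consumes it (blueprint (DOM): «implementers `q_k`,
`proj q_k = ι(k)`, `c₁ ≤ L(q_k) ≤ c₂`»):

* `norm_omega_apply_le_of_proj_eq` — the one-point comparison with the constant `√(c₂/c₁)`;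
* `exists_piSchwartzBruhat_dominating_of_proj_eq` — **if `{ω(q' s)Φ : s ∈ S}` is dominated by `Φ₀ ∈ 𝒮(𝔸_Fⁿ)`,
  `π(q s) = π(q' s)`, `L(q s) ≤ c₂` and `0 < c₁ ≤ L(q' s)`, then `{ω(q s)Φ}` is dominated by `√(c₂/c₁) · Φ₀`;**
* `exists_piSchwartzBruhat_dominating_implementers_of_omega_comp` — combined with ★ `AdelicCompactFamilyDominated.
  exists_piSchwartzBruhat_dominating_omega_comp`: every implementer family `q` lying over `s(C)`, `C` compact, for a
  continuous homomorphism `s : H →* Mp_ψ(W_𝔸)ᶜᵒⁿᵗ` with archimedean covariant data, with moduli bounded above (and those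
  of `s` bounded below on `C`), is dominated by one real non-negative Schwartz–Bruhat function.

Cell hodgecm-mathlib, FLOOR 0, engine E-2 (crux item H413, `--supports stmt-HodgeConjecture-24833`), row G3 ∕ (DOM) of
the SW2c-BOUND assembly sheet.  HC_CM is proved only modulo the printed citations until rung 0 closes; nothing here is
about Hodge classes.

## References
* [Weil1964] A. Weil, *Sur certains groupes d'opérateurs unitaires*, Acta Math. 111 (1964) 143–211, Chap. I n° 13
  p. 160, Chap. III n° 41 Lemme 5 p. 194.
* [Weil1965] A. Weil, *Sur la formule de Siegel dans la théorie des groupes classiques*, Acta Math. 113 (1965) 1–87,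
  Chap. V n° 47, n° 50.
-/

set_option autoImplicit false

noncomputable section

open scoped ENNReal Topology Classical
open _root_.MeasureTheory NumberField NumberField.mixedEmbedding IsDedekindDomain Set Filter

namespace Literature.NumberTheory.Weil1964

open Literature.NumberTheory.Automorphic Literature.RepresentationTheory.HeisenbergGroup

variable (F : Type) [Field F] [NumberField F] {n : ℕ}
variable (T : Matrix (Fin n) (Fin n) (AdeleRing (𝓞 F) F)) (hT : IsUnit T.det)
variable [MeasurableSpace (AdeleRing (𝓞 F) F)] [BorelSpace (AdeleRing (𝓞 F) F)]
variable (ν : Measure (Fin n → AdeleRing (𝓞 F) F)) [ν.IsAddHaarMeasure]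

/-! ## §1 One point: bounded modulus ratio -/

/-- **Implementers of the same element compare by `√(L(q)/L(q'))`**: if `π(q') = π(q)`, `L(q) ≤ c₂` and
`0 < c₁ ≤ L(q')`, then `‖(ω(q)Φ)(x)‖ ≤ √(c₂/c₁) · ‖(ω(q')Φ)(x)‖`. [cite: Weil1964, Chap. I n° 13 p. 160] [cite: Weil1965, Chap. V n° 47] -/
theorem norm_omega_apply_le_of_proj_eq (q q' : adelicMpCont F (Fin n) T)
    (h : adelicMpCont.proj F (Fin n) T q' = adelicMpCont.proj F (Fin n) T q) {c₁ c₂ : ℝ} (hc₁ : 0 < c₁)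
    (hL : (adelicMpCont.l2Scaling F T hT ν q).toReal ≤ c₂) (hL' : c₁ ≤ (adelicMpCont.l2Scaling F T hT ν q').toReal)
    (Φ : piSchwartzBruhat F (Fin n)) (x : Fin n → AdeleRing (𝓞 F) F) :
    ‖((adelicMpCont.omega F (Fin n) T q Φ : piSchwartzBruhat F (Fin n)) : (Fin n → AdeleRing (𝓞 F) F) → ℂ) x‖ ≤
      Real.sqrt (c₂ / c₁) *
        ‖((adelicMpCont.omega F (Fin n) T q' Φ : piSchwartzBruhat F (Fin n)) : (Fin n → AdeleRing (𝓞 F) F) → ℂ) x‖ := by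
  rw [adelicMpCont.norm_omega_apply_of_proj_eq F T hT ν q' q h Φ x]
  refine mul_le_mul_of_nonneg_right (Real.sqrt_le_sqrt ?_) (norm_nonneg _)
  have hq' : 0 < (adelicMpCont.l2Scaling F T hT ν q').toReal := hc₁.trans_le hL'
  rw [div_le_div_iff₀ hq' hc₁]
  exact mul_le_mul hL hL' hc₁.le ((ENNReal.toReal_nonneg).trans hL)

/-! ## §2 Families: domination transfers across implementer families of bounded modulus -/

/-- **Domination transfers to every implementer family of bounded modulus**: if `‖(ω(q' s)Φ)(x)‖ ≤ (Φ₀ x).re` for all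
`s ∈ S₀` with `Φ₀ ∈ 𝒮(𝔸_Fⁿ)` real non-negative, and `q` is another family with `π(q s) = π(q' s)`, `L(q s) ≤ c₂`,
`0 < c₁ ≤ L(q' s)`, then `{ω(q s)Φ : s ∈ S₀}` is dominated by the real non-negative Schwartz–Bruhat function
`√(c₂/c₁) · Φ₀`. [cite: Weil1964, Chap. III n° 41, Lemme 5 p. 194] [cite: Weil1965, Chap. V n° 50] -/
theorem exists_piSchwartzBruhat_dominating_of_proj_eq {S : Type*} {S₀ : Set S}
    (q q' : S → adelicMpCont F (Fin n) T)
    (hproj : ∀ s ∈ S₀, adelicMpCont.proj F (Fin n) T (q' s) = adelicMpCont.proj F (Fin n) T (q s))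
    {c₁ c₂ : ℝ} (hc₁ : 0 < c₁) (hL : ∀ s ∈ S₀, (adelicMpCont.l2Scaling F T hT ν (q s)).toReal ≤ c₂)
    (hL' : ∀ s ∈ S₀, c₁ ≤ (adelicMpCont.l2Scaling F T hT ν (q' s)).toReal) (Φ : piSchwartzBruhat F (Fin n))
    {Φ₀ : (Fin n → AdeleRing (𝓞 F) F) → ℂ} (hΦ₀ : Φ₀ ∈ piSchwartzBruhat F (Fin n))
    (hr : ∀ x, (Φ₀ x).im = 0 ∧ 0 ≤ (Φ₀ x).re)
    (hdom : ∀ s ∈ S₀, ∀ x,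
      ‖((adelicMpCont.omega F (Fin n) T (q' s) Φ : piSchwartzBruhat F (Fin n)) : (Fin n → AdeleRing (𝓞 F) F) → ℂ) x‖ ≤
        (Φ₀ x).re) :
    ∃ Φ₁ : (Fin n → AdeleRing (𝓞 F) F) → ℂ, Φ₁ ∈ piSchwartzBruhat F (Fin n) ∧
      (∀ x, (Φ₁ x).im = 0 ∧ 0 ≤ (Φ₁ x).re) ∧ ∀ s ∈ S₀, ∀ x,
        ‖((adelicMpCont.omega F (Fin n) T (q s) Φ : piSchwartzBruhat F (Fin n)) : (Fin n → AdeleRing (𝓞 F) F) → ℂ) x‖ ≤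
          (Φ₁ x).re := by
  have hmem : (fun x => (Real.sqrt (c₂ / c₁) : ℂ) * Φ₀ x) ∈ piSchwartzBruhat F (Fin n) :=
    Submodule.smul_mem _ ((Real.sqrt (c₂ / c₁) : ℝ) : ℂ) hΦ₀
  refine ⟨fun x => (Real.sqrt (c₂ / c₁) : ℂ) * Φ₀ x, hmem, fun x => ?_, fun s hs x => ?_⟩
  · obtain ⟨h1, h2⟩ := hr x
    refine ⟨?_, ?_⟩
    · show ((Real.sqrt (c₂ / c₁) : ℂ) * Φ₀ x).im = 0
      rw [Complex.mul_im, Complex.ofReal_re, Complex.ofReal_im, h1, mul_zero, zero_mul, add_zero]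
    · show 0 ≤ ((Real.sqrt (c₂ / c₁) : ℂ) * Φ₀ x).re
      rw [Complex.mul_re, Complex.ofReal_re, Complex.ofReal_im, h1, mul_zero, sub_zero]
      exact mul_nonneg (Real.sqrt_nonneg _) h2
  · obtain ⟨h1, -⟩ := hr x
    have hre : ((Real.sqrt (c₂ / c₁) : ℂ) * Φ₀ x).re = Real.sqrt (c₂ / c₁) * (Φ₀ x).re := by
      rw [Complex.mul_re, Complex.ofReal_re, Complex.ofReal_im, h1, mul_zero, sub_zero]
    exact (norm_omega_apply_le_of_proj_eq F T hT ν (q s) (q' s) (hproj s hs) hc₁ (hL s hs) (hL' s hs) Φ x).trans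
      ((mul_le_mul_of_nonneg_left (hdom s hs x) (Real.sqrt_nonneg _)).trans_eq hre.symm)

/-! ## §3 Implementer families over the image of a continuous homomorphism with archimedean data -/

section OmegaComp

variable {H : Type*} [Group H] [TopologicalSpace H] [IsTopologicalGroup H]

/-- **Every implementer family over `s(C)` with bounded moduli is dominated** (`C ⊆ H` compact, `s : H →* Mp_ψ(W_𝔸)ᶜᵒⁿᵗ`
continuous with archimedean covariant data `W_∞` as in ★ `hasThetaMajorants_omega_comp`): for `q : S → Mp_ψ(W_𝔸)ᶜᵒⁿᵗ` and
`h : S → H` with `h(S₀) ⊆ C`, `π(q s) = π(s (h s))`, `L(q s) ≤ c₂`, `0 < c₁ ≤ L(s (h s))` on `S₀`, one real non-negative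
`Φ₁ ∈ 𝒮(𝔸_Fⁿ)` satisfies `‖(ω(q s)Φ)(x)‖ ≤ (Φ₁ x).re` for all `s ∈ S₀`, `x`.
[cite: Weil1964, Chap. III n° 41, Lemme 5 p. 194] [cite: Weil1965, Chap. V n° 50] -/
theorem exists_piSchwartzBruhat_dominating_implementers_of_omega_comp (hT' : IsUnit T)
    (s : H →* adelicMpCont F (Fin n) T) (hs : Continuous s)
    (Winf : H → (SchwartzMap (Fin n → mixedSpace F) ℂ →L[ℂ] SchwartzMap (Fin n → mixedSpace F) ℂ))
    (w0 : ∀ h, Winf h ≠ 0) (w1 : ∀ Φ, Continuous fun h => Winf h Φ)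
    (w2 : ∀ (h : H) (a w : Fin n → mixedSpace F) (Φ : SchwartzMap (Fin n → mixedSpace F) ℂ),
      Winf h (archModTrans F (Fin n) T a w Φ) =
        weilPhase T (adelicMpCont.proj F (Fin n) T (s h)) (a, w) •
          archModTrans F (Fin n) T (archAct T (adelicMpCont.proj F (Fin n) T (s h)) (a, w)).1
            (archAct T (adelicMpCont.proj F (Fin n) T (s h)) (a, w)).2 (Winf h Φ))
    (Φ : piSchwartzBruhat F (Fin n)) {C : Set H} (hC : IsCompact C)
    {S : Type*} {S₀ : Set S} (q : S → adelicMpCont F (Fin n) T) (h : S → H) (hh : ∀ t ∈ S₀, h t ∈ C)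
    (hproj : ∀ t ∈ S₀, adelicMpCont.proj F (Fin n) T (s (h t)) = adelicMpCont.proj F (Fin n) T (q t))
    {c₁ c₂ : ℝ} (hc₁ : 0 < c₁) (hL : ∀ t ∈ S₀, (adelicMpCont.l2Scaling F T hT ν (q t)).toReal ≤ c₂)
    (hL' : ∀ t ∈ S₀, c₁ ≤ (adelicMpCont.l2Scaling F T hT ν (s (h t))).toReal) :
    ∃ Φ₁ : (Fin n → AdeleRing (𝓞 F) F) → ℂ, Φ₁ ∈ piSchwartzBruhat F (Fin n) ∧
      (∀ x, (Φ₁ x).im = 0 ∧ 0 ≤ (Φ₁ x).re) ∧ ∀ t ∈ S₀, ∀ x,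
        ‖((adelicMpCont.omega F (Fin n) T (q t) Φ : piSchwartzBruhat F (Fin n)) : (Fin n → AdeleRing (𝓞 F) F) → ℂ) x‖ ≤
          (Φ₁ x).re := by
  obtain ⟨Φ₀, hΦ₀, hr, hdom⟩ := exists_piSchwartzBruhat_dominating_omega_comp hT' s hs Winf w0 w1 w2 Φ hC
  exact exists_piSchwartzBruhat_dominating_of_proj_eq F T hT ν q (fun t => s (h t)) hproj hc₁ hL hL' Φ hΦ₀ hr
    fun t ht x => hdom (h t) (hh t ht) x

end OmegaComp

end Literature.NumberTheory.Weil1964
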